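import Mathlib
import Literature.AlgebraicGeometry.Resolution.CobordantGame
import Literature.AlgebraicGeometry.Resolution.CobordantChartOneMove

/-!
# `WeightedInvariant.LocalWeightedDrop`: one-move wins with a cone smooth OFF THE VERTEX DIRECTIONS; the F11 node (§9 R4-5)

Route `ResolutionOfSingularities/WeightedInvariant`, crux `LocalWeightedDrop`
(stmt-ResolutionOfSingularities-8899).  [OURS · L1 W4.3]  Nothing here is a statement of the manuscript under
review on ladder RESOLUTION; AI-produced, weaker than expert review.

The tree's one-move win `CobordantChart.crux_move_wins_of_isWeightedHomogeneous` asks the affine cone of the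
`w`-homogeneous germ `P` to be smooth off the origin of ALL of `kⁿ`.  For a centre that is not a point
(`wᵢ = 0` for some `i`) that hypothesis is never satisfied by a germ idle in a weight-zero variable (the cone
contains the `xᵢ`-axis), although the move still wins: the crux's chart only visits exceptional points `c`
SUPPORTED ON THE POSITIVE-WEIGHT COORDINATES.  This file records the sharper form, whose proof is the tree's
verbatim with the support hypothesis threaded through, and packages it as a `CobordantGame.Won` statement:

* `successor_nonsingular_of_isWeightedHomogeneous_offVertex`, `crux_move_wins_of_isWeightedHomogeneous_offVertex`
  — cone condition only for `c` with `cᵢ = 0` whenever `wᵢ = 0`;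
* `isMove_X` — the identity coordinate change with any weight vector having a positive entry is a legal move;
* `won_of_isWeightedHomogeneous_offVertex` — such a germ is WON (one move, no singular successor);
* `f11_won` — §9 R4-5 of res-L1-w43-idea-1's `Sketch-L1-idea-1.lean` v4: the F11 umbrella node
  `Z² + z·w′² ∈ k⟦Z, w′, z, y, s₁⟧` is won by the ONE move «centre `V(Z, w′)`, weights `(1,1,0,0,0)`» — in EVERY
  characteristic (the sketch asks for `p = 2`, `k` algebraically closed): on the support `c₂ = c₃ = c₄ = 0`,
  `∂P/∂z = w′²` and `P = Z² + z w′²` vanish only at `c = 0`.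
-/

set_option linter.dupNamespace false -- mandated namespace of this single-conjunct summit
set_option autoImplicit false

namespace Summit.ResolutionOfSingularities.ResolutionOfSingularities.Theorems

namespace GradedGame

open Literature.AlgebraicGeometry.Resolution
open Literature.AlgebraicGeometry.Resolution.CobordantChart

variable {k : Type} [Field k] {n : ℕ}

/-- ONE-MOVE WIN, cone smooth OFF THE VERTEX DIRECTIONS.  As `CobordantChart.successor_nonsingular_of_isWeightedHomogeneous`,
but the cone hypothesis `P(c) = 0 ∧ ∇P(c) = 0 ⇒ c = 0` is only required for points `c` with `cᵢ = 0` whenever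
`wᵢ = 0` — the only points the chart `chart w c` is evaluated at. [OURS · L1 W4.3; proof = the tree's verbatim] -/
theorem successor_nonsingular_of_isWeightedHomogeneous_offVertex (w : Fin n → ℕ) {P : MvPolynomial (Fin n) k}
    {a : ℕ} (hP : P.IsWeightedHomogeneous w a) (hP0 : P ≠ 0)
    (hcone : ∀ c : Fin n → k, (∀ i, w i = 0 → c i = 0) → MvPolynomial.eval c P = 0 →
      (∀ i, MvPolynomial.eval c (MvPolynomial.pderiv i P) = 0) → c = 0)
    (c : Fin n → k) (hc : ∀ i, w i = 0 → c i = 0) (hcne : c ≠ 0)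
    {e : ℕ} {g : MvPowerSeries (Fin (n + 1)) k}
    (hfac : MvPowerSeries.subst (chart w c) (P : MvPowerSeries (Fin n) k) = MvPowerSeries.X 0 ^ e * g)
    (hg : ¬ MvPowerSeries.X 0 ∣ g) :
    ¬ (MvPowerSeries.constantCoeff g = 0 ∧ ∀ j, MvPowerSeries.coeff (Finsupp.single j 1) g = 0) := by
  classical
  have hP0' : (P : MvPowerSeries (Fin n) k) ≠ 0 := by
    intro h; apply hP0; exact MvPolynomial.coe_eq_zero_iff.mp h
  have he : e = a := by
    have h1 := eq_weightedOrder_of_factor w c hc hP0' hfac hg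
    rw [weightedOrder_coe_of_isWeightedHomogeneous w hP hP0] at h1
    exact_mod_cast h1
  subst he
  intro hsing
  obtain ⟨hPa, hD, -⟩ := (successor_singular_iff w c hc _ hfac).mp hsing
  rw [initEval_coe, hP.weightedHomogeneousComponent_same] at hPa
  have hD' : ∀ i, MvPolynomial.eval c (MvPolynomial.pderiv i P) = 0 := by
    intro i
    have := hD i
    rwa [initEvalD_coe, hP.weightedHomogeneousComponent_same] at this
  exact hcne (hcone c hc hPa hD')

/-- The crux's form of `successor_nonsingular_of_isWeightedHomogeneous_offVertex`: the move `θ = X`, weights `w`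
leaves NO singular `s`-saturated successor at any off-vertex point of the crux's chart family.
[OURS · L1 W4.3; proof = the tree's verbatim] -/
theorem crux_move_wins_of_isWeightedHomogeneous_offVertex (w : Fin n → ℕ) {P : MvPolynomial (Fin n) k}
    {a : ℕ} (hP : P.IsWeightedHomogeneous w a) (hP0 : P ≠ 0)
    (hcone : ∀ c : Fin n → k, (∀ i, w i = 0 → c i = 0) → MvPolynomial.eval c P = 0 →
      (∀ i, MvPolynomial.eval c (MvPolynomial.pderiv i P) = 0) → c = 0)
    (c : Fin n → k) (hoff : ∃ i, 0 < w i ∧ c i ≠ 0) (e : ℕ) (g : MvPowerSeries (Fin (n + 1)) k)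
    (hfac : MvPowerSeries.subst (fun i : Fin n => if 0 < w i then
        MvPowerSeries.X (0 : Fin (n + 1)) ^ (w i) * (MvPowerSeries.C (c i) + MvPowerSeries.X i.succ)
        else MvPowerSeries.X i.succ)
        (MvPowerSeries.subst (MvPowerSeries.X : Fin n → MvPowerSeries (Fin n) k)
          (P : MvPowerSeries (Fin n) k)) = MvPowerSeries.X 0 ^ e * g)
    (hg : ¬ MvPowerSeries.X 0 ∣ g) :
    ¬ (MvPowerSeries.constantCoeff g = 0 ∧ ∀ j, MvPowerSeries.coeff (Finsupp.single j 1) g = 0) := by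
  rw [cruxChart_eq_chart, MvPowerSeries.subst_self] at hfac
  refine successor_nonsingular_of_isWeightedHomogeneous_offVertex w hP hP0 hcone _ (fun i hi => ?_) ?_ hfac hg
  · have : ¬ 0 < w i := by omega
    simp [this]
  · obtain ⟨i, hi, hci⟩ := hoff
    intro h
    have := congrFun h i
    simp [hi] at this
    exact hci this

/-- The identity coordinate change with a weight vector having a positive entry is a LEGAL MOVE. [OURS · L1 W4.3] -/
theorem isMove_X (w : Fin n → ℕ) (hw : ∃ i, 0 < w i) :
    CobordantGame.IsMove k (MvPowerSeries.X : Fin n → MvPowerSeries (Fin n) k) w := by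
  classical
  refine ⟨fun i => MvPowerSeries.constantCoeff_X i, ?_, hw⟩
  have hM : (Matrix.of fun i j : Fin n => MvPowerSeries.coeff (Finsupp.single j 1)
      (MvPowerSeries.X i : MvPowerSeries (Fin n) k)) = (1 : Matrix (Fin n) (Fin n) k) := by
    ext a b
    rw [Matrix.of_apply, MvPowerSeries.coeff_X, Matrix.one_apply]
    by_cases h : a = b
    · subst h; simp
    · rw [if_neg, if_neg h]
      intro h'
      exact h ((Finsupp.single_left_inj one_ne_zero).mp h').symm
  rw [hM, Matrix.det_one]
  exact isUnit_one

/-- ONE-MOVE WIN AS A `Won` STATEMENT: a non-zero `w`-weighted-homogeneous polynomial germ whose affine cone is smooth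
off the vertex directions is WON — the move `(X, w)` has no singular successor. [OURS · L1 W4.3] -/
theorem won_of_isWeightedHomogeneous_offVertex (w : Fin n → ℕ) (hw : ∃ i, 0 < w i) {P : MvPolynomial (Fin n) k}
    {a : ℕ} (hP : P.IsWeightedHomogeneous w a) (hP0 : P ≠ 0)
    (hcone : ∀ c : Fin n → k, (∀ i, w i = 0 → c i = 0) → MvPolynomial.eval c P = 0 →
      (∀ i, MvPolynomial.eval c (MvPolynomial.pderiv i P) = 0) → c = 0) :
    CobordantGame.Won k n (P : MvPowerSeries (Fin n) k) := by
  refine CobordantGame.Won.move MvPowerSeries.X w (isMove_X w hw) fun g hg => ?_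
  obtain ⟨c, e, hoff, hfac, hndvd, hsing⟩ := hg
  exact absurd hsing (crux_move_wins_of_isWeightedHomogeneous_offVertex w hP hP0 hcone c hoff e g hfac hndvd)

/-- R4-5 — THE F11 UMBRELLA NODE IS WON IN ONE MOVE (centre `V(Z, w′)`, weights `(1,1,0,0,0)`; variables
`0 = Z, 1 = w′, 2 = z, 3 = y, 4 = s₁`): no successor is singular.  Holds over EVERY field (the sketch's
`[CharP k 2] [IsAlgClosed k]` are not needed): at an exceptional point `c = (c₀, c₁, 0, 0, 0)`,
`∂P/∂z (c) = c₁²` and `P(c) = c₀² + c₂c₁²` vanish only for `c = 0`.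
[OURS · L1 W4.3, Sketch-L1-idea-1 v4 §9 R4-5] -/
theorem f11_won : CobordantGame.Won k 5
    (MvPowerSeries.X 0 ^ 2 + MvPowerSeries.X 2 * MvPowerSeries.X 1 ^ 2 : MvPowerSeries (Fin 5) k) := by
  classical
  set w : Fin 5 → ℕ := fun i => if i = 0 ∨ i = 1 then 1 else 0 with hw
  set P : MvPolynomial (Fin 5) k := MvPolynomial.X 0 ^ 2 + MvPolynomial.X 2 * MvPolynomial.X 1 ^ 2 with hPdef
  have hcoe : (P : MvPowerSeries (Fin 5) k) =
      MvPowerSeries.X 0 ^ 2 + MvPowerSeries.X 2 * MvPowerSeries.X 1 ^ 2 := by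
    simp [hPdef, MvPolynomial.coe_add, MvPolynomial.coe_mul, MvPolynomial.coe_pow, MvPolynomial.coe_X]
  rw [← hcoe]
  have hw0 : w 0 = 1 := by simp [hw]
  have hw1 : w 1 = 1 := by simp [hw]
  have hw2 : w 2 = 0 := by simp [hw]
  have hP : P.IsWeightedHomogeneous w 2 := by
    have h0 := MvPolynomial.isWeightedHomogeneous_X (R := k) w 0
    have h1 := MvPolynomial.isWeightedHomogeneous_X (R := k) w 1
    have h2 := MvPolynomial.isWeightedHomogeneous_X (R := k) w 2
    rw [hw0] at h0
    rw [hw1] at h1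
    rw [hw2] at h2
    have hA' : (MvPolynomial.X 0 ^ 2 : MvPolynomial (Fin 5) k).IsWeightedHomogeneous w (2 • 1) := h0.pow 2
    have hB' : (MvPolynomial.X 2 * MvPolynomial.X 1 ^ 2 : MvPolynomial (Fin 5) k).IsWeightedHomogeneous w (0 + 2 • 1) :=
      h2.mul (h1.pow 2)
    have e1 : (2 • 1 : ℕ) = 2 := rfl
    have e2 : (0 + 2 • 1 : ℕ) = 2 := rfl
    rw [e1] at hA'
    rw [e2] at hB'
    rw [hPdef]
    exact hA'.add hB'
  have hP0 : P ≠ 0 := by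
    intro h
    have := congrArg (MvPolynomial.coeff (Finsupp.single (0 : Fin 5) 2)) h
    rw [hPdef, MvPolynomial.coeff_add, MvPolynomial.coeff_X_pow, if_pos rfl, MvPolynomial.coeff_zero] at this
    have hz : MvPolynomial.coeff (Finsupp.single (0 : Fin 5) 2)
        (MvPolynomial.X 2 * MvPolynomial.X 1 ^ 2 : MvPolynomial (Fin 5) k) = 0 := by
      rw [show (MvPolynomial.X 2 * MvPolynomial.X 1 ^ 2 : MvPolynomial (Fin 5) k) =
          MvPolynomial.monomial (Finsupp.single 2 1 + Finsupp.single 1 2) 1 by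
        rw [MvPolynomial.X, MvPolynomial.X_pow_eq_monomial, MvPolynomial.monomial_mul, one_mul],
        MvPolynomial.coeff_monomial, if_neg]
      intro h'
      have := DFunLike.congr_fun h' 0
      simp at this
    rw [hz, add_zero] at this
    exact one_ne_zero this
  refine won_of_isWeightedHomogeneous_offVertex w ⟨0, by simp [hw0]⟩ hP hP0 fun c hc hPc hD => ?_
  have hc2 : c 2 = 0 := hc 2 hw2
  have hD2 := hD 2
  have hpd : MvPolynomial.pderiv 2 P = MvPolynomial.X 1 ^ 2 := by
    rw [hPdef, map_add, (MvPolynomial.pderiv 2).leibniz_pow, (MvPolynomial.pderiv 2).leibniz,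
      (MvPolynomial.pderiv 2).leibniz_pow, MvPolynomial.pderiv_X, MvPolynomial.pderiv_X, MvPolynomial.pderiv_X]
    simp
  rw [hpd] at hD2
  simp only [map_pow, MvPolynomial.eval_X] at hD2
  have hc1 : c 1 = 0 := pow_eq_zero_iff (n := 2) (by norm_num) |>.mp hD2
  rw [hPdef] at hPc
  simp only [map_add, map_mul, map_pow, MvPolynomial.eval_X, hc1, hc2] at hPc
  have hc0 : c 0 = 0 := by simpa using hPc
  funext i
  fin_cases i
  · exact hc0
  · exact hc1
  · exact hc2
  · exact hc 3 (by simp [hw])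
  · exact hc 4 (by simp [hw])

end GradedGame

end Summit.ResolutionOfSingularities.ResolutionOfSingularities.Theorems
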